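import Summits.HubbardSuperconductivity.HubbardSuperconductivity.Theses.AposterioriCapRg

/-!
# Crux `CapRgSymmetricCertificatePinned` (item `stmt-HubbardSuperconductivity-14045`, route
# `AposterioriCapRg`): symmetry transport for Salmhofer's effective-action calculus

Negative-side support lemmas from the standing disprover (cdisprove, cycle 2, 2026-08-16; part 3a —
the generic engine behind `FreeFrame.lean` (no certificate at `U = 0` in any frame) and
`RotationCovariance.lean` (`C₄` covariance of the certified functionals)).  Nothing here asserts a
Theses decl.  Everything is over an arbitrary commutative `ℚ`-algebra `R` and label set `Γ`.

* §A1 **Substitution versus derivative**: `grassmannDeriv_map` — for every linear substitution `f` of the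
  generator space, `∂_X (f_* a) = f_* ((e_X^* ∘ f) ⌋ a)`; `constPart_map`; the nilpotent `exp`/`log`
  commute with `f_*` (`map_grassmannExp'`, `map_grassmannLog1p`).
* §A2 **Laplacian-commuting substitutions**: if `Δ_C ∘ f_* = f_* ∘ Δ_C` then `f_*` commutes with the
  Gaussian convolution `μ_C ⋆ = e^{Δ_C}` (`gaussConv_map_of_comm`) and FIXES the effective action of every
  `f_*`-invariant nilpotent interaction (`map_effAction_eq_self_of_comm`: `f_* 𝒢 = 𝒢`).
* §A3 **Diagonal scalings (gauge transformations)** `diagScale c : ψ(X) ↦ c_X ψ(X)`: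
  `grassmannDeriv_map_diagScale` (`∂_X ∘ c_* = c_X · c_* ∘ ∂_X`), `kernel_map_diagScale`
  (`kernel (c_* F) m X = (∏ c_{X_i}) · kernel F m X`), `grassmannLaplacian_map_diagScale`
  (`Δ_C ∘ c_* = c_* ∘ Δ_{cCc}`), hence `Δ_C`-commutation when `c_X c_Y C(X,Y) = C(X,Y)`
  (`grassmannLaplacian_map_diagScale_of_inv`), `map_diagScale_effAction`, and the **selection rule**
  `kernel_eq_zero_of_map_diagScale_eq`: kernels of a gauge-invariant `F` vanish at label tuples whose
  gauge weight `∏ c_{X_i}` differs from `1` by a unit.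
* §A4 **Relabellings** `relabel σ : ψ(Y) ↦ ψ(σ Y)` for a permutation `σ` of the labels:
  `grassmannDeriv_map_relabel` (`∂_X ∘ σ_* = σ_* ∘ ∂_{σ⁻¹ X}`), `kernel_map_relabel`
  (`kernel (σ_* F) m X = kernel F m (σ⁻¹ ∘ X)`), `grassmannLaplacian_map_relabel`
  (`Δ_C ∘ σ_* = σ_* ∘ Δ_{C ∘ (σ × σ)}`), hence `Δ_C`-commutation when `C (σ U) (σ V) = C U V`,
  `map_relabel_effAction`, and **covariance of the kernels** `kernel_comp_perm_of_map_relabel_eq`: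
  `kernel F m (σ ∘ X) = kernel F m X` for a `σ`-invariant `F`.

Sources: folklore (symmetries of Gaussian Grassmann integration: Benfatto–Giuliani–Mastropietro 2006
§2.1 (1)–(8); Salmhofer 1999 App. B.3), here for the `e^{Δ_C}` calculus of `GrassmannLaplacian.lean`.
-/

noncomputable section

namespace Summit.HubbardSuperconductivity.CapRgSymmetricCertificatePinned.Negative

open Literature.MathematicalPhysics.QuantumLattice GrassmannAlgebra Finset Matrix
open scoped BigOperators

/-! ## §A1 Substitution versus derivative, constant part, `exp` and `log` -/

section Subst

variable (R : Type*) [CommRing R] {Γ : Type*}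

/-- **Derivative versus substitution**: for a linear substitution `f` of the generator space,
`∂_X (f_* a) = f_* (d_{e_X ∘ f} ⌋ a)` (contraction by the pulled-back coordinate form). [folklore] -/
theorem grassmannDeriv_map (f : (Γ → R) →ₗ[R] (Γ → R)) (X : Γ) (a : GrassmannAlgebra R Γ) :
    grassmannDeriv R X (ExteriorAlgebra.map f a) =
      ExteriorAlgebra.map f (CliffordAlgebra.contractLeft ((LinearMap.proj X).comp f) a) := by
  induction a using CliffordAlgebra.left_induction with
  | algebraMap r =>
    rw [AlgHom.commutes, grassmannDeriv_algebraMap, CliffordAlgebra.contractLeft_algebraMap, map_zero]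
  | add x y hx hy => rw [map_add, map_add, hx, hy, map_add, map_add]
  | ι_mul x m hx =>
    rw [map_mul (ExteriorAlgebra.map f), CliffordAlgebra.contractLeft_ι_mul, map_sub (ExteriorAlgebra.map f),
      map_smul (ExteriorAlgebra.map f), map_mul (ExteriorAlgebra.map f)]
    erw [ExteriorAlgebra.map_apply_ι]
    rw [grassmannDeriv_ι_mul, hx, LinearMap.comp_apply, LinearMap.proj_apply]

/-- The constant part is invariant under substitutions. [folklore] -/
theorem constPart_map (f : (Γ → R) →ₗ[R] (Γ → R)) (a : GrassmannAlgebra R Γ) :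
    constPart R (ExteriorAlgebra.map f a) = constPart R a := by
  have h : (constPart R (Γ := Γ)).comp (ExteriorAlgebra.map f) = constPart R (Γ := Γ) := by
    refine ExteriorAlgebra.hom_ext ?_
    refine LinearMap.ext fun v => ?_
    simp only [LinearMap.comp_apply, AlgHom.toLinearMap_apply, AlgHom.comp_apply,
      ExteriorAlgebra.map_apply_ι, constPart_ι]
  exact congrArg (fun φ : GrassmannAlgebra R Γ →ₐ[R] R => φ a) h

variable [Algebra ℚ R]

/-- Substitutions commute with the nilpotent exponential. [folklore] -/
theorem map_grassmannExp' (f : (Γ → R) →ₗ[R] (Γ → R)) {a : GrassmannAlgebra R Γ} (ha : IsNilpotent a) :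
    ExteriorAlgebra.map f (grassmannExp a) = grassmannExp (ExteriorAlgebra.map f a) :=
  IsNilpotent.map_exp ha _

/-- Substitutions commute with the truncated logarithm (nilpotent argument). [folklore] -/
theorem map_grassmannLog1p (f : (Γ → R) →ₗ[R] (Γ → R)) {x : GrassmannAlgebra R Γ} (hx : IsNilpotent x) :
    ExteriorAlgebra.map f (grassmannLog1p R x) = grassmannLog1p R (ExteriorAlgebra.map f x) := by
  have hm : x ^ nilpotencyClass x = 0 := pow_nilpotencyClass hx
  have hm' : (ExteriorAlgebra.map f x) ^ nilpotencyClass x = 0 := by rw [← map_pow, hm, map_zero]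
  rw [grassmannLog1p_eq_sum R hm', grassmannLog1p, map_sum]
  refine Finset.sum_congr rfl fun k _ => ?_
  rw [map_rat_smul, map_pow]

/-- The truncated logarithm of a non-nilpotent element is the junk value `0`. [folklore] -/
theorem grassmannLog1p_of_not_isNilpotent {y : GrassmannAlgebra R Γ} (hn : ¬ IsNilpotent y) :
    grassmannLog1p R y = 0 := by
  rw [grassmannLog1p, nilpotencyClass, Nat.sInf_eq_zero.2 (Or.inr ?_), Finset.range_zero, Finset.sum_empty]
  ext k
  exact ⟨fun hk => hn ⟨k, hk⟩, fun h => h.elim⟩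

end Subst

/-! ## §A2 Laplacian-commuting substitutions commute with `μ_C ⋆` and fix the effective action -/

section Comm

variable (R : Type*) [CommRing R] [Algebra ℚ R] {Γ : Type*} [Fintype Γ]

/-- If `Δ_C` commutes with `f_*`, so do its powers. [folklore] -/
theorem grassmannLaplacian_pow_map_of_comm {C : Matrix Γ Γ R} {f : (Γ → R) →ₗ[R] (Γ → R)}
    (hf : ∀ a, grassmannLaplacian R C (ExteriorAlgebra.map f a) = ExteriorAlgebra.map f (grassmannLaplacian R C a))
    (k : ℕ) (a : GrassmannAlgebra R Γ) :
    (grassmannLaplacian R C ^ k) (ExteriorAlgebra.map f a) = ExteriorAlgebra.map f ((grassmannLaplacian R C ^ k) a) := by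
  induction k with
  | zero => simp
  | succ k ih => rw [pow_succ', Module.End.mul_apply, ih, hf, Module.End.mul_apply]

/-- **A Laplacian-commuting substitution commutes with the Gaussian convolution** `μ_C ⋆ = e^{Δ_C}`.
[folklore] -/
theorem gaussConv_map_of_comm {C : Matrix Γ Γ R} {f : (Γ → R) →ₗ[R] (Γ → R)}
    (hf : ∀ a, grassmannLaplacian R C (ExteriorAlgebra.map f a) = ExteriorAlgebra.map f (grassmannLaplacian R C a))
    (a : GrassmannAlgebra R Γ) :
    gaussConv R C (ExteriorAlgebra.map f a) = ExteriorAlgebra.map f (gaussConv R C a) := by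
  obtain ⟨k, hk⟩ := isNilpotent_grassmannLaplacian R C
  rw [gaussConv, IsNilpotent.exp_eq_sum hk, LinearMap.coe_sum, Finset.sum_apply, Finset.sum_apply, map_sum]
  refine Finset.sum_congr rfl fun i _ => ?_
  rw [LinearMap.smul_apply, LinearMap.smul_apply, grassmannLaplacian_pow_map_of_comm R hf, map_rat_smul]

/-- **A Laplacian-commuting substitution fixes the effective action of every invariant nilpotent
interaction**: `f_* (effAction C V) = effAction C V`. [folklore] -/
theorem map_effAction_eq_self_of_comm {C : Matrix Γ Γ R} {f : (Γ → R) →ₗ[R] (Γ → R)}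
    (hf : ∀ a, grassmannLaplacian R C (ExteriorAlgebra.map f a) = ExteriorAlgebra.map f (grassmannLaplacian R C a))
    {V : GrassmannAlgebra R Γ} (hV : IsNilpotent V) (hinv : ExteriorAlgebra.map f V = V) :
    ExteriorAlgebra.map f (effAction R C V) = effAction R C V := by
  have hB : ExteriorAlgebra.map f (effBoltzmann R C V) = effBoltzmann R C V := by
    rw [effBoltzmann, ← gaussConv_map_of_comm R hf, map_grassmannExp' R _ hV.neg, map_neg, hinv]
  set y := Ring.inverse (effPartitionFn R C V) • effBoltzmann R C V - 1 with hy
  have hy' : ExteriorAlgebra.map f y = y := by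
    rw [hy, map_sub, map_smul, hB, map_one]
  rw [effAction, map_neg]
  congr 1
  by_cases hn : IsNilpotent y
  · rw [map_grassmannLog1p R _ hn, hy']
  · rw [grassmannLog1p_of_not_isNilpotent R hn, map_zero]

end Comm

/-! ## §A3 Diagonal scalings (gauge transformations) -/

section Diag

variable (R : Type*) [CommRing R] {Γ : Type*}

/-- The **diagonal scaling** `v ↦ (X ↦ c_X v_X)` of the generator space (`ψ(X) ↦ c_X ψ(X)`). [folklore] -/
def diagScale (c : Γ → R) : (Γ → R) →ₗ[R] (Γ → R) :=
  LinearMap.pi fun X => c X • (LinearMap.proj X : (Γ → R) →ₗ[R] R)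

/-- `(c · v)_X = c_X v_X`. [folklore] -/
theorem diagScale_apply (c : Γ → R) (v : Γ → R) (X : Γ) : diagScale R c v X = c X * v X := by
  simp [diagScale]

/-- The coordinate form pulls back to a multiple of itself: `e_X^* ∘ c = c_X e_X^*`. [folklore] -/
theorem proj_comp_diagScale (c : Γ → R) (X : Γ) :
    (LinearMap.proj X : (Γ → R) →ₗ[R] R).comp (diagScale R c) = c X • (LinearMap.proj X) := by
  refine LinearMap.ext fun v => ?_
  simp [diagScale_apply]

/-- The scaling on a basis vector. [folklore] -/
theorem diagScale_single [DecidableEq Γ] (c : Γ → R) (Y : Γ) :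
    diagScale R c (Pi.single Y 1) = c Y • (Pi.single Y 1 : Γ → R) := by
  ext X
  rw [diagScale_apply, Pi.smul_apply, smul_eq_mul, Pi.single_apply]
  split_ifs with h
  · subst h; ring
  · ring

/-- `(c)_* ψ(Y) = c_Y ψ(Y)`. [folklore] -/
theorem map_diagScale_gen [DecidableEq Γ] (c : Γ → R) (Y : Γ) :
    ExteriorAlgebra.map (diagScale R c) (gen R Y) = c Y • gen R Y := by
  rw [gen, ExteriorAlgebra.map_apply_ι, diagScale_single, map_smul]

/-- `∂_X ((c)_* a) = c_X · (c)_* (∂_X a)`. [folklore] -/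
theorem grassmannDeriv_map_diagScale (c : Γ → R) (X : Γ) (a : GrassmannAlgebra R Γ) :
    grassmannDeriv R X (ExteriorAlgebra.map (diagScale R c) a) =
      c X • ExteriorAlgebra.map (diagScale R c) (grassmannDeriv R X a) := by
  rw [grassmannDeriv_map, proj_comp_diagScale, map_smul, LinearMap.smul_apply, map_smul]
  rfl

variable [Algebra ℚ R]

omit [Algebra ℚ R] in
/-- Iterated derivatives versus the diagonal scaling: `∂_X ((c)_* a) = (∏ c_{X_i}) · (c)_* (∂_X a)`.
[folklore] -/
theorem iterDeriv_map_diagScale (c : Γ → R) {m : ℕ} (X : Fin m → Γ) (a : GrassmannAlgebra R Γ) :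
    iterDeriv R X (ExteriorAlgebra.map (diagScale R c) a) =
      (∏ i, c (X i)) • ExteriorAlgebra.map (diagScale R c) (iterDeriv R X a) := by
  induction m with
  | zero => simp [iterDeriv]
  | succ m ih =>
    have hsplit : ∀ b : GrassmannAlgebra R Γ, iterDeriv R X b =
        grassmannDeriv R (X (Fin.last m)) (iterDeriv R (fun i => X i.castSucc) b) := fun b => by
      simp only [iterDeriv, List.ofFn_succ', List.concat_eq_append, List.reverse_append,
        List.reverse_singleton, List.singleton_append, List.prod_cons, Module.End.mul_apply]
    rw [hsplit, ih, map_smul, grassmannDeriv_map_diagScale, smul_smul, hsplit, Fin.prod_univ_castSucc,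
      mul_comm]

/-- **Kernels scale**: `kernel ((c)_* F) m X = (∏ c_{X_i}) · kernel F m X`. [folklore] -/
theorem kernel_map_diagScale (c : Γ → R) (F : GrassmannAlgebra R Γ) (m : ℕ) (X : Fin m → Γ) :
    kernel R (ExteriorAlgebra.map (diagScale R c) F) m X = (∏ i, c (X i)) * kernel R F m X := by
  rw [kernel_def, kernel_def, iterDeriv_map_diagScale, map_smul, constPart_map, smul_eq_mul]
  ring

/-- **Selection rule**: the kernels of a gauge-invariant `F` vanish at every label tuple whose total
gauge weight `∏ c_{X_i}` differs from `1` by a unit. [folklore] -/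
theorem kernel_eq_zero_of_map_diagScale_eq {c : Γ → R} {F : GrassmannAlgebra R Γ}
    (hF : ExteriorAlgebra.map (diagScale R c) F = F) {m : ℕ} {X : Fin m → Γ}
    (hX : IsUnit (∏ i, c (X i) - 1)) : kernel R F m X = 0 := by
  have h := kernel_map_diagScale R c F m X
  rw [hF] at h
  have h2 : (∏ i, c (X i) - 1) * kernel R F m X = 0 := by rw [sub_mul, one_mul, ← h, sub_self]
  exact (hX.mul_right_eq_zero).1 h2

variable [Fintype Γ]

/-- The Laplacian versus the diagonal scaling: `Δ_C ((c)_* a) = (c)_* (Δ_{c C c} a)`. [folklore] -/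
theorem grassmannLaplacian_map_diagScale (C : Matrix Γ Γ R) (c : Γ → R) (a : GrassmannAlgebra R Γ) :
    grassmannLaplacian R C (ExteriorAlgebra.map (diagScale R c) a) =
      ExteriorAlgebra.map (diagScale R c)
        (grassmannLaplacian R (Matrix.of fun X Y => c X * c Y * C X Y) a) := by
  rw [grassmannLaplacian_apply, grassmannLaplacian_apply, map_smul, map_sum]
  congr 1
  refine Finset.sum_congr rfl fun X _ => ?_
  rw [map_sum]
  refine Finset.sum_congr rfl fun Y _ => ?_
  rw [grassmannDeriv_map_diagScale, map_smul, grassmannDeriv_map_diagScale, map_smul, Matrix.of_apply,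
    smul_smul, smul_smul]
  congr 1
  ring

/-- **Gauge covariance of the Laplacian**: if the scaling preserves the covariance
(`c_X c_Y C(X,Y) = C(X,Y)`), then `Δ_C` commutes with `(c)_*`. [folklore] -/
theorem grassmannLaplacian_map_diagScale_of_inv {C : Matrix Γ Γ R} {c : Γ → R}
    (hC : ∀ X Y, c X * c Y * C X Y = C X Y) (a : GrassmannAlgebra R Γ) :
    grassmannLaplacian R C (ExteriorAlgebra.map (diagScale R c) a) =
      ExteriorAlgebra.map (diagScale R c) (grassmannLaplacian R C a) := by
  have h : (Matrix.of fun X Y => c X * c Y * C X Y) = C := by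
    ext X Y
    rw [Matrix.of_apply, hC]
  rw [grassmannLaplacian_map_diagScale, h]

/-- **Gauge invariance of the effective action**: if the diagonal scaling `(c)_*` preserves the
covariance and the (nilpotent) interaction, it fixes `effAction C V`. [folklore] -/
theorem map_diagScale_effAction {C : Matrix Γ Γ R} {c : Γ → R}
    (hC : ∀ X Y, c X * c Y * C X Y = C X Y) {V : GrassmannAlgebra R Γ} (hV : IsNilpotent V)
    (hinv : ExteriorAlgebra.map (diagScale R c) V = V) :
    ExteriorAlgebra.map (diagScale R c) (effAction R C V) = effAction R C V :=
  map_effAction_eq_self_of_comm R (grassmannLaplacian_map_diagScale_of_inv R hC) hV hinv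

end Diag

/-! ## §A4 Relabellings (permutations of the labels) -/

section Relabel

variable (R : Type*) [CommRing R] {Γ : Type*}

/-- The **relabelling substitution** of a permutation `σ` of the labels: `(σ · v)_X = v_{σ⁻¹ X}`, so that
`σ_* ψ(Y) = ψ(σ Y)`. [folklore] -/
def relabel (σ : Equiv.Perm Γ) : (Γ → R) →ₗ[R] (Γ → R) :=
  LinearMap.funLeft R R σ.symm

/-- `(σ · v)_X = v_{σ⁻¹ X}`. [folklore] -/
theorem relabel_apply (σ : Equiv.Perm Γ) (v : Γ → R) (X : Γ) : relabel R σ v X = v (σ.symm X) := rfl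

/-- The coordinate form pulls back to a coordinate form: `e_X^* ∘ σ = e_{σ⁻¹ X}^*`. [folklore] -/
theorem proj_comp_relabel (σ : Equiv.Perm Γ) (X : Γ) :
    (LinearMap.proj X : (Γ → R) →ₗ[R] R).comp (relabel R σ) = LinearMap.proj (σ.symm X) :=
  LinearMap.ext fun _ => rfl

/-- The relabelling on a basis vector. [folklore] -/
theorem relabel_single [DecidableEq Γ] (σ : Equiv.Perm Γ) (Y : Γ) :
    relabel R σ (Pi.single Y 1) = (Pi.single (σ Y) 1 : Γ → R) := by
  ext X
  rw [relabel_apply, Pi.single_apply, Pi.single_apply]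
  by_cases h : X = σ Y
  · rw [if_pos h, if_pos ((Equiv.symm_apply_eq σ).2 h)]
  · rw [if_neg h, if_neg (fun h' => h ((Equiv.symm_apply_eq σ).1 h'))]

/-- `σ_* ψ(Y) = ψ(σ Y)`. [folklore] -/
theorem map_relabel_gen [DecidableEq Γ] (σ : Equiv.Perm Γ) (Y : Γ) :
    ExteriorAlgebra.map (relabel R σ) (gen R Y) = gen R (σ Y) := by
  rw [gen, ExteriorAlgebra.map_apply_ι, relabel_single, gen]

/-- `∂_X (σ_* a) = σ_* (∂_{σ⁻¹ X} a)`. [folklore] -/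
theorem grassmannDeriv_map_relabel (σ : Equiv.Perm Γ) (X : Γ) (a : GrassmannAlgebra R Γ) :
    grassmannDeriv R X (ExteriorAlgebra.map (relabel R σ) a) =
      ExteriorAlgebra.map (relabel R σ) (grassmannDeriv R (σ.symm X) a) := by
  rw [grassmannDeriv_map, proj_comp_relabel]
  rfl

variable [Algebra ℚ R]

omit [Algebra ℚ R] in
/-- Iterated derivatives versus relabelling: `∂_X (σ_* a) = σ_* (∂_{σ⁻¹ ∘ X} a)`. [folklore] -/
theorem iterDeriv_map_relabel (σ : Equiv.Perm Γ) {m : ℕ} (X : Fin m → Γ) (a : GrassmannAlgebra R Γ) :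
    iterDeriv R X (ExteriorAlgebra.map (relabel R σ) a) =
      ExteriorAlgebra.map (relabel R σ) (iterDeriv R (fun i => σ.symm (X i)) a) := by
  induction m with
  | zero => simp [iterDeriv]
  | succ m ih =>
    have hsplit : ∀ (Y : Fin (m + 1) → Γ) (b : GrassmannAlgebra R Γ), iterDeriv R Y b =
        grassmannDeriv R (Y (Fin.last m)) (iterDeriv R (fun i => Y i.castSucc) b) := fun Y b => by
      simp only [iterDeriv, List.ofFn_succ', List.concat_eq_append, List.reverse_append,
        List.reverse_singleton, List.singleton_append, List.prod_cons, Module.End.mul_apply]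
    rw [hsplit, ih, grassmannDeriv_map_relabel, hsplit]

/-- **Kernels relabel**: `kernel (σ_* F) m X = kernel F m (σ⁻¹ ∘ X)`. [folklore] -/
theorem kernel_map_relabel (σ : Equiv.Perm Γ) (F : GrassmannAlgebra R Γ) (m : ℕ) (X : Fin m → Γ) :
    kernel R (ExteriorAlgebra.map (relabel R σ) F) m X = kernel R F m (fun i => σ.symm (X i)) := by
  rw [kernel_def, kernel_def, iterDeriv_map_relabel, constPart_map]

/-- **Covariance of the kernels**: for a `σ`-invariant `F`, `kernel F m (σ ∘ X) = kernel F m X`. [folklore] -/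
theorem kernel_comp_perm_of_map_relabel_eq {σ : Equiv.Perm Γ} {F : GrassmannAlgebra R Γ}
    (hF : ExteriorAlgebra.map (relabel R σ) F = F) (m : ℕ) (X : Fin m → Γ) :
    kernel R F m (fun i => σ (X i)) = kernel R F m X := by
  have h := kernel_map_relabel R σ F m (fun i => σ (X i))
  rw [hF] at h
  rw [h]
  simp only [Equiv.symm_apply_apply]

variable [Fintype Γ]

/-- The Laplacian versus relabelling: `Δ_C (σ_* a) = σ_* (Δ_{C ∘ (σ × σ)} a)`. [folklore] -/
theorem grassmannLaplacian_map_relabel (C : Matrix Γ Γ R) (σ : Equiv.Perm Γ) (a : GrassmannAlgebra R Γ) :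
    grassmannLaplacian R C (ExteriorAlgebra.map (relabel R σ) a) =
      ExteriorAlgebra.map (relabel R σ) (grassmannLaplacian R (Matrix.of fun U V => C (σ U) (σ V)) a) := by
  rw [grassmannLaplacian_apply, grassmannLaplacian_apply, map_smul, map_sum]
  congr 1
  rw [← Equiv.sum_comp σ]
  refine Finset.sum_congr rfl fun U _ => ?_
  rw [map_sum, ← Equiv.sum_comp σ]
  refine Finset.sum_congr rfl fun V _ => ?_
  rw [grassmannDeriv_map_relabel, grassmannDeriv_map_relabel, map_smul, Matrix.of_apply,
    Equiv.symm_apply_apply, Equiv.symm_apply_apply]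

/-- **Covariance of the Laplacian**: if the covariance is `σ`-invariant (`C (σ U) (σ V) = C U V`) then
`Δ_C` commutes with `σ_*`. [folklore] -/
theorem grassmannLaplacian_map_relabel_of_inv {C : Matrix Γ Γ R} {σ : Equiv.Perm Γ}
    (hC : ∀ U V, C (σ U) (σ V) = C U V) (a : GrassmannAlgebra R Γ) :
    grassmannLaplacian R C (ExteriorAlgebra.map (relabel R σ) a) =
      ExteriorAlgebra.map (relabel R σ) (grassmannLaplacian R C a) := by
  have h : (Matrix.of fun U V => C (σ U) (σ V)) = C := by
    ext U V
    rw [Matrix.of_apply, hC]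
  rw [grassmannLaplacian_map_relabel, h]

/-- **Invariance of the effective action under a symmetry of covariance and interaction**:
`σ_* (effAction C V) = effAction C V`. [folklore] -/
theorem map_relabel_effAction {C : Matrix Γ Γ R} {σ : Equiv.Perm Γ}
    (hC : ∀ U V, C (σ U) (σ V) = C U V) {V : GrassmannAlgebra R Γ} (hV : IsNilpotent V)
    (hinv : ExteriorAlgebra.map (relabel R σ) V = V) :
    ExteriorAlgebra.map (relabel R σ) (effAction R C V) = effAction R C V :=
  map_effAction_eq_self_of_comm R (grassmannLaplacian_map_relabel_of_inv R hC) hV hinv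

end Relabel

end Summit.HubbardSuperconductivity.CapRgSymmetricCertificatePinned.Negative

end
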